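import Summits.NavierStokesRegularity.NavierStokesRegularity.Theorems.SoloRefuteWashburn2026Tilted

/-!
# C159 `Washburn2026` — tilted Burgers layers (II): kernel refutations of the integral faces,
# Step 2 (Cor 5.3 (5.1) p.6 l.110–119) and Step 4 (Prop 7.2 p.9 l.16–43)

On the slab box `[1/(4κ), 1/(2κ)] × [−d, d]²` (volume `d²/κ`) the tilted layer `W7 κ ∈ IsAE 1` of part I
has `ρ^{3/2}|∇ξ|² ≥ 9κ²/2500` and `|∇ξ|² ≥ κ²/100`; hence `E_ω(0,0;1) ≥ 9κ/10⁴` (box `d = 1/2` inside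
`B(0,1)`, time length `1`) and `∬_{Q_δ}|∇ξ|² ≥ κδ⁴/400` (box `d = δ/2`). Letting `κ → ∞` refutes
`Cor53_Coherence` (the universal-constant coherence estimate (5.1), FIRST failing step of the chain on
the typed class) and `Prop72_BelowStruwe` (the below-Struwe smallness with a universal `δ`).
WHAT THIS IS NOT: not a claim about NS regularity or blow-up; not a claim about any author beyond the
typed locator.
-/

set_option linter.dupNamespace false
noncomputable section
open Real Set Function InnerProductSpace MeasureTheory
open scoped RealInnerProductSpace ContDiff Topology ENNReal Laplacian

namespace Summit.NavierStokesRegularity.NavierStokesRegularity.Theorems.Washburn2026Tilted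
open Literature.Analysis.FluidPDE Literature.Analysis.FluidPDE.StrainedShear
open Literature.Claims.NS.Washburn2026 (E3 rho xi gradXi Eomega IsAE Cor53_Coherence Prop72_BelowStruwe
  Theorem74_GradBound Step1_75_Transfer Theorem75_DirectionConstancy)

/-! ## The slab box and the lower bounds on the direction-coherence integrals -/

/-- Lower corner of the box. [folklore] -/
def lo (κ d : ℝ) : Fin 3 → ℝ := ![1 / (4 * κ), -d, -d]

/-- Upper corner of the box. [folklore] -/
def hi (κ d : ℝ) : Fin 3 → ℝ := ![1 / (2 * κ), d, d]

/-- The box `[1/(4κ), 1/(2κ)] × [−d, d]²`. [folklore] -/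
def box (κ d : ℝ) : Set E3 := (WithLp.ofLp : E3 → Fin 3 → ℝ) ⁻¹' Icc (lo κ d) (hi κ d)

/-- Membership in the box, coordinatewise. [folklore] -/
theorem mem_box {κ d : ℝ} {x : E3} (hx : x ∈ box κ d) :
    (1 / (4 * κ) ≤ x 0 ∧ x 0 ≤ 1 / (2 * κ)) ∧ (-d ≤ x 1 ∧ x 1 ≤ d) ∧ (-d ≤ x 2 ∧ x 2 ≤ d) := by
  obtain ⟨h1, h2⟩ := hx
  exact ⟨⟨h1 0, h2 0⟩, ⟨h1 1, h2 1⟩, ⟨h1 2, h2 2⟩⟩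

/-- The box is measurable. [folklore] -/
theorem measurableSet_box (κ d : ℝ) : MeasurableSet (box κ d) :=
  measurableSet_Icc.preimage (PiLp.volume_preserving_ofLp (Fin 3)).measurable

/-- `vol(box) = (1/(4κ)) (2d)²` (`κ > 0`, `d ≥ 0`). [folklore] -/
theorem volume_box {κ d : ℝ} (hκ : 0 < κ) (hd : 0 ≤ d) :
    volume (box κ d) = ENNReal.ofReal (1 / (4 * κ) * (2 * d) ^ 2) := by
  rw [box, (PiLp.volume_preserving_ofLp (Fin 3)).measure_preimage measurableSet_Icc.nullMeasurableSet,
    Real.volume_Icc_pi]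
  simp only [Fin.prod_univ_three, lo, hi, Matrix.cons_val_zero, Matrix.cons_val_one, Matrix.cons_val_two,
    Matrix.head_cons, Matrix.tail_cons]
  have hk : 0 ≤ 1 / (2 * κ) - 1 / (4 * κ) :=
    sub_nonneg.2 (one_div_le_one_div_of_le (by positivity) (by linarith))
  rw [← ENNReal.ofReal_mul hk, ← ENNReal.ofReal_mul (mul_nonneg hk (by linarith))]
  congr 1
  field_simp
  ring

/-- The box lies in the ball `B(0, R)` once `1/(2κ) ≤ d` and `2d ≤ R`. [folklore] -/
theorem box_subset_ball {κ d R : ℝ} (hκ : 0 < κ) (hd : 1 / (2 * κ) ≤ d) (hR : 2 * d ≤ R) :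
    box κ d ⊆ Metric.ball (0 : E3) R := by
  intro x hx
  obtain ⟨⟨h0a, h0b⟩, ⟨h1a, h1b⟩, ⟨h2a, h2b⟩⟩ := mem_box hx
  have hd0 : 0 < d := lt_of_lt_of_le (by positivity) hd
  have h0 : 0 ≤ x 0 := le_trans (by positivity) h0a
  have hx0 : x 0 ^ 2 ≤ d ^ 2 := pow_le_pow_left₀ h0 (h0b.trans hd) 2
  have hx1 : x 1 ^ 2 ≤ d ^ 2 := sq_le_sq' h1a h1b
  have hx2 : x 2 ^ 2 ≤ d ^ 2 := sq_le_sq' h2a h2b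
  have hd2 : 0 < d ^ 2 := by positivity
  rw [mem_ball_zero_iff, EuclideanSpace.norm_eq, Real.sqrt_lt' (by linarith)]
  simp only [Fin.sum_univ_three, Real.norm_eq_abs, sq_abs]
  nlinarith

/-- **Box lower bound**: `m · vol(box) ≤ ∫_S G` if `G ≥ m` on the box and `box ⊆ S`. [folklore] -/
theorem lintegral_ge_box {κ d m : ℝ} {G : E3 → ℝ} {S : Set E3} (hsub : box κ d ⊆ S)
    (hG : ∀ x ∈ box κ d, m ≤ G x) :
    ENNReal.ofReal m * volume (box κ d) ≤ ∫⁻ x in S, ENNReal.ofReal (G x) :=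
  calc ENNReal.ofReal m * volume (box κ d) = ∫⁻ _ in box κ d, ENNReal.ofReal m :=
        (setLIntegral_const _ _).symm
    _ ≤ ∫⁻ x in box κ d, ENNReal.ofReal (G x) :=
        setLIntegral_mono' (measurableSet_box κ d) fun x hx => ENNReal.ofReal_le_ofReal (hG x hx)
    _ ≤ ∫⁻ x in S, ENNReal.ofReal (G x) := lintegral_mono_set hsub

/-- The `E_ω` integrand is `≥ 9κ²/2500` on the slab (`ρ^{3/2} ≥ ρ² ≥ 9/25`, `|∇ξ|² ≥ κ²/100`). [folklore] -/
theorem integrand_ge {κ : ℝ} (hκ : 0 < κ) (t : ℝ) {x : E3} (h1 : 1 / (4 * κ) ≤ x 0)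
    (h2 : x 0 ≤ 1 / (2 * κ)) :
    9 * κ ^ 2 / 2500 ≤ rho (W7 κ) t x ^ (3 / 2 : ℝ) * ‖gradXi (W7 κ) t x‖ ^ 2 := by
  have hgrad := gradXi_ge hκ t h1 h2
  have hρ0 := rho_pos hκ t x
  have hρ : 9 / 25 ≤ rho (W7 κ) t x ^ (3 / 2 : ℝ) :=
    calc (9 / 25 : ℝ) ≤ q κ (x 0) := (q_bounds κ (x 0)).1.le
      _ = rho (W7 κ) t x ^ (2 : ℝ) := by
          rw [Real.rpow_two, rho_W7 hκ, Real.sq_sqrt (by linarith [(q_bounds κ (x 0)).1])]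
      _ ≤ rho (W7 κ) t x ^ (3 / 2 : ℝ) :=
          Real.rpow_le_rpow_of_exponent_ge hρ0 (rho_le_one hκ t x) (by norm_num)
  have hg2 : (κ / 10) ^ 2 ≤ ‖gradXi (W7 κ) t x‖ ^ 2 := by gcongr
  calc 9 * κ ^ 2 / 2500 = 9 / 25 * (κ / 10) ^ 2 := by ring
    _ ≤ _ := mul_le_mul hρ hg2 (by positivity) (by positivity)

/-- **`E_ω(0, 0; 1) ≥ 9κ/10⁴` for `W7 κ`** (`κ ≥ 1`). [cite: Washburn2026, Def 2.5 p.4 l.90–96] -/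
theorem Eomega_ge {κ : ℝ} (hκ : 1 ≤ κ) : ENNReal.ofReal (9 * κ / 10000) ≤ Eomega (W7 κ) 0 0 1 := by
  have hκ0 : 0 < κ := by linarith
  have hd : 1 / (2 * κ) ≤ 1 / 2 := one_div_le_one_div_of_le (by norm_num) (by linarith)
  have hsub : box κ (1 / 2) ⊆ Metric.ball (0 : E3) 1 := box_subset_ball hκ0 hd (by norm_num)
  have inner : ∀ t : ℝ, ENNReal.ofReal (9 * κ / 10000) ≤ ∫⁻ x in Metric.ball (0 : E3) 1,
      ENNReal.ofReal (rho (W7 κ) t x ^ (3 / 2 : ℝ) * ‖gradXi (W7 κ) t x‖ ^ 2) := by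
    intro t
    have h := lintegral_ge_box hsub fun x hx => integrand_ge hκ0 t (mem_box hx).1.1 (mem_box hx).1.2
    calc ENNReal.ofReal (9 * κ / 10000)
        = ENNReal.ofReal (9 * κ ^ 2 / 2500) * volume (box κ (1 / 2)) := by
          rw [volume_box hκ0 (by norm_num), ← ENNReal.ofReal_mul (by positivity)]
          congr 1
          field_simp
          ring
      _ ≤ _ := h
  unfold Eomega
  calc ENNReal.ofReal (9 * κ / 10000)
      = ∫⁻ _ in Ioo ((0 : ℝ) - 1 ^ 2) 0, ENNReal.ofReal (9 * κ / 10000) := by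
        rw [setLIntegral_const, Real.volume_Ioo]
        norm_num
    _ ≤ _ := lintegral_mono fun t => inner t

/-! ## Refutations of the integral faces: Steps 2 and 4 -/

/-- **Refutes Step 2 — Corollary 5.3 (5.1) p.6 l.110–119** («for the ancient element and 0 < R ≤ 1,
E_ω(z₀, R) ≤ C₁R⁵ + C₂R³», constants universal): for `W7 κ ∈ IsAE 1`,
`E_ω(0,0;1) ≥ 9κ/10⁴ > C₁ + C₂` once `κ = (10⁴/9)(C₁ + C₂) + 1`. refuted-substantive for the class as
typed (the direction-coherence scale of an `IsAE` member is not universal). [cite: Washburn2026, Cor 5.3 (5.1) p.6 l.110–119] -/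
theorem not_Cor53_Coherence : ¬ Cor53_Coherence := by
  intro h
  obtain ⟨C₁, C₂, hC₁, hC₂, hb⟩ := h 1 one_pos
  set κ : ℝ := 10000 / 9 * (C₁ + C₂) + 1 with hκ
  have hκ1 : 1 ≤ κ := by
    have : 0 ≤ 10000 / 9 * (C₁ + C₂) := by positivity
    linarith
  have h1 := hb (W7 κ) (P7 κ) (isAE_W7 (by linarith)) 0 0 le_rfl 1 one_pos le_rfl
  have h2 := (Eomega_ge hκ1).trans h1
  rw [ENNReal.ofReal_le_ofReal_iff (by positivity)] at h2
  have h3 : 9 * κ / 10000 = C₁ + C₂ + 9 / 10000 := by rw [hκ]; ring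
  norm_num at h2
  linarith

/-- **Refutes Step 4 — Proposition 7.2 p.9 l.16–43** («∬_{Q_δ(0,0)} |∇ξ|² ≤ E₀* ≪ 4π» with universal
`δ`): for `W7 κ ∈ IsAE 1` the integral over `Q_δ` is `≥ κδ⁴/400 ≥ 16 > 4π` once
`κ = 1/δ + 6400/δ⁴`. [cite: Washburn2026, Prop 7.2 p.9 l.16–43] -/
theorem not_Prop72_BelowStruwe : ¬ Prop72_BelowStruwe := by
  intro h
  obtain ⟨δ, E₀, hδ, hE₀, hb⟩ := h 1 one_pos
  set κ : ℝ := 1 / δ + 6400 / δ ^ 4 with hκ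
  have hκ0 : 0 < κ := by positivity
  have hκδ : 1 / (2 * κ) ≤ δ / 2 := by
    have h1 : 1 / δ ≤ κ := by
      have : 0 ≤ 6400 / δ ^ 4 := by positivity
      linarith
    have h2 : 2 / δ ≤ 2 * κ := by rw [div_eq_mul_one_div 2 δ]; linarith
    calc 1 / (2 * κ) ≤ 1 / (2 / δ) := one_div_le_one_div_of_le (by positivity) h2
      _ = δ / 2 := by field_simp
  have hsub : box κ (δ / 2) ⊆ Metric.ball (0 : E3) δ := box_subset_ball hκ0 hκδ (by linarith)
  have hI := hb (W7 κ) (P7 κ) (isAE_W7 hκ0)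
  have inner : ∀ t : ℝ, ENNReal.ofReal (κ ^ 2 / 100) * volume (box κ (δ / 2)) ≤
      ∫⁻ x in Metric.ball (0 : E3) δ,
        ENNReal.ofReal (if 0 < rho (W7 κ) t x then ‖gradXi (W7 κ) t x‖ ^ 2 else 0) := by
    intro t
    refine lintegral_ge_box hsub fun x hx => ?_
    rw [if_pos (rho_pos hκ0 t x)]
    have hg := gradXi_ge hκ0 t (mem_box hx).1.1 (mem_box hx).1.2
    calc κ ^ 2 / 100 = (κ / 10) ^ 2 := by ring
      _ ≤ _ := by gcongr
  have hkey : 16 ≤ κ ^ 2 / 100 * (1 / (4 * κ) * (2 * (δ / 2)) ^ 2) * (0 - -δ ^ 2) := by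
    have hk : κ * δ ^ 4 = δ ^ 3 + 6400 := by
      rw [hκ]
      field_simp
    have hδ3 : 0 < δ ^ 3 := by positivity
    have : κ ^ 2 / 100 * (1 / (4 * κ) * (2 * (δ / 2)) ^ 2) * (0 - -δ ^ 2) = κ * δ ^ 4 / 400 := by
      field_simp
      ring
    rw [this, hk]
    linarith
  have htot : ENNReal.ofReal 16 ≤ ∫⁻ t in Ioo (-δ ^ 2) 0, ∫⁻ x in Metric.ball (0 : E3) δ,
      ENNReal.ofReal (if 0 < rho (W7 κ) t x then ‖gradXi (W7 κ) t x‖ ^ 2 else 0) :=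
    calc ENNReal.ofReal 16
        ≤ ENNReal.ofReal (κ ^ 2 / 100 * (1 / (4 * κ) * (2 * (δ / 2)) ^ 2) * (0 - -δ ^ 2)) :=
          ENNReal.ofReal_le_ofReal hkey
      _ = ENNReal.ofReal (κ ^ 2 / 100) * volume (box κ (δ / 2)) * volume (Ioo (-δ ^ 2) (0 : ℝ)) := by
          rw [volume_box hκ0 (by linarith), Real.volume_Ioo, ← ENNReal.ofReal_mul (by positivity),
            ← ENNReal.ofReal_mul (by positivity)]
      _ = ∫⁻ _ in Ioo (-δ ^ 2) (0 : ℝ), ENNReal.ofReal (κ ^ 2 / 100) * volume (box κ (δ / 2)) :=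
          (setLIntegral_const _ _).symm
      _ ≤ _ := lintegral_mono fun t => inner t
  have h16 := htot.trans hI
  rw [ENNReal.ofReal_le_ofReal_iff'] at h16
  rcases h16 with h16 | h16
  · linarith [Real.pi_le_four]
  · norm_num at h16

/-- Summary: Steps 2, 4, 5, 6 and 8 (literal) are all false on the typed class `IsAE`, by one family.
[cite: Washburn2026, Cor 5.3 p.6; Prop 7.2, Thm 7.4, Thm 7.5 p.9] -/
theorem five_faces_false : ¬ Cor53_Coherence ∧ ¬ Prop72_BelowStruwe ∧ ¬ Theorem74_GradBound ∧
    ¬ Step1_75_Transfer ∧ ¬ Theorem75_DirectionConstancy :=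
  ⟨not_Cor53_Coherence, not_Prop72_BelowStruwe, not_Theorem74_GradBound, not_Step1_75_Transfer,
    not_Theorem75_DirectionConstancy⟩

end Summit.NavierStokesRegularity.NavierStokesRegularity.Theorems.Washburn2026Tilted
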